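import Summits.CriticalPhenomena.PercolationContinuityZ3.Theorems.PercNearOneGluingNoHeavyLowerTailKnQuestion8Spectators
import HarnessLib

/-!
# Kozma–Nitzan's Question 8: the "observer reaches a AND a prescribed set" brackets are nonnegative at the
# pocket-designated relay — one relay's hypothesis suffices (hp-7 gen 34, memo FROM-prim-hp-7-g34-Q8-TWO-OBSERVER §5(a))

Support file for the (closed) crux `PercNearOneGluingNoHeavy.NoHeavyLowerTail` (stmt-CriticalPhenomena-4575), seat
`prim-hp-7` (gen 34).  No definitions, no named facts, no sorries; standard axioms.

Setting (Kozma–Nitzan, arXiv:2401.12397 §5.5 p. 36, Questions 8/9): observer `o`, target `b`, a relay `c` and another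
relay `a`, an arbitrary vertex set `A''` (further relays) and an avoided set `Z ∋ c`, `o ∉ Z` for the observer.  For
`|A| = 3`, `A = {c, k, k'}`, the margin of (41) at `c` splits along the set of relays reached by `o`,
`μ(o↔A, o↔b) − μ(o↔A, c↔b) = [E_k] + [E_k'] + [E_kk']` with `[E] := μ(E ∩ {o↮c} ∩ {o↔b}) − μ(E ∩ {o↮c} ∩ {c↔b})`
and `E_kk' = {o↔k} ∩ {o↔k'}`.  ineq-gen-6's `KnQ8Z.knQuestion8Z_pair` gives `[E_k] + [E_kk'] ≥ 0` from the single
comparison `μ(c↔b, o↮Z) ≤ μ(k↔b, o↮Z)`.  THIS FILE proves that the same single comparison also gives the JOINT bracket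
`[E_kk'] ≥ 0`, and more generally `[{o↔a} ∩ {o↔A''}] ≥ 0` for every vertex set `A''`:

* `KnQ8J.ratio_transfer_joint` — the four-term transfer of `…KnQuestion8SpectatorTransfer.lean` with the off-increasing
  event `Q = {o↔a} ∩ ⋂_{a''∈A''} {o↔a''}` in place of `{o↔a}`;
* `KnQ8J.joint_core` / `joint_of_lt_one` / `KnQ8J.joint` — designation form: no sure pairs, `a ≠ c`, `o ≠ c`, `c ∈ Z ∌ o`,
  `μ({c↔b} ∩ {o↮Z}) ≤ μ({a↔b} ∩ {o↮Z})` ⟹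
  `μ({o↔a} ∩ {o↔A''} ∩ {o↮c} ∩ {c↔b}) ≤ μ({o↔a} ∩ {o↔A''} ∩ {o↮c} ∩ {o↔b})`;
* `KnQ8J.reachBoth` — the case `A'' = {a'}`: the bracket "o reaches both `a` and `a'`, not `c`" is nonnegative.
Exact census (hp-7 gen 34, all graphs sampled on ≤ 7 vertices): the three brackets are the complete anatomy of
Question 8 at three relays; `[E_k] < 0` and `[E_k'] < 0` simultaneously in ≈ 1 % of pocket-designated instances, where
`[E_kk']` carries both deficits.
[cite: KozmaNitzan2024, Questions 8–9 (§5.5 p. 36), display (41)] [cite: VandenbergHaggstromKahn2005, Thms. 1.3–1.5 (pp. 6–8)]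
-/

noncomputable section

namespace Summit.CriticalPhenomena.PercolationContinuityZ3.Theorems

open MeasureTheory Set
open Literature.Probability.LatticeModels (prodBernoulli)
open Literature.Probability.Percolation
open Literature.Probability.Percolation.BHK2006 (openGraph_le)
open Summit.CriticalPhenomena.PercolationContinuityZ3.Cruxes.AdditiveGluing.TieLine
open scoped Classical

namespace KnQ8J

variable {V : Type*} [Fintype V]

/-- `D⟦s, X⟧ = {s ↮ X}` (source abbreviation of `{ω | ∀ x ∈ X, ¬ (openGraph ω).Reachable s x}`). -/
local notation3 (prettyPrint := false) "D⟦" s ", " X "⟧" =>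
  {ω : BondConfig V | ∀ x ∈ X, ¬ (openGraph ω).Reachable s x}

/-- `B⟦W, s⟧ = W̄`, the pairs meeting `{s} ∪ V(W)` (source abbreviation, as in the off-cluster file). -/
local notation3 (prettyPrint := false) "B⟦" W ", " s "⟧" => {e : Sym2 V | ∃ v ∈ e, v = s ∨ ∃ e' ∈ W, v ∈ e'}

/-- `J⟦o, a, A''⟧ = {o ↔ a} ∩ ⋂_{a'' ∈ A''} {o ↔ a''}` (source abbreviation). -/
local notation3 (prettyPrint := false) "J⟦" o ", " a ", " A "⟧" =>
  ((openConn o a : Set (BondConfig V)) ∩ {ω : BondConfig V | ∀ x ∈ A, (openGraph ω).Reachable o x})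

/-! ### The four-term transfer with a joint reach event -/

/-- **Four-term transfer with the joint reach event.**  Vertices `o, a, c, b`, sets `A''`, `Z`, `X` with `o ∈ X`, `c ∉ X`,
`D = {c ↮ X}`, `J = {o↔a} ∩ ⋂_{a''∈A''}{o↔a''}`:
`μ(D ∩ J ∩ {c↔b}) · μ(D ∩ {o↮Z} ∩ ({a↔b} ∩ {a↮c})) ≤ μ(D ∩ J ∩ ({a↔b} ∩ {a↮c})) · μ(D ∩ {o↮Z} ∩ {c↔b})`.
(`KnQ8Z.ratio_transfer`: on `D`, `J` and `{a↔b} ∩ {a↮c}` are increasing events of the configuration off `C̄_c`,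
`{c↔b}` is cluster-increasing and `{o↮Z}` is off-decreasing.)
[cite: VandenbergHaggstromKahn2005, Thms. 1.3–1.5 (pp. 6–8)] [cite: KozmaNitzan2024, Questions 8–9 (p. 36)] -/
theorem ratio_transfer_joint (w : Sym2 V → unitInterval) (o a c b : V) (A'' X : Set V) (hoX : o ∈ X) (hcX : c ∉ X)
    (Z : Set V) :
    (prodBernoulli w).real (D⟦c, X⟧ ∩ J⟦o, a, A''⟧ ∩ openConn c b) *
      (prodBernoulli w).real (D⟦c, X⟧ ∩ {ω | ∀ z ∈ Z, ¬ (openGraph ω).Reachable o z} ∩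
        (openConn a b ∩ (openConn a c)ᶜ)) ≤
    (prodBernoulli w).real (D⟦c, X⟧ ∩ J⟦o, a, A''⟧ ∩ (openConn a b ∩ (openConn a c)ᶜ)) *
      (prodBernoulli w).real (D⟦c, X⟧ ∩ {ω | ∀ z ∈ Z, ¬ (openGraph ω).Reachable o z} ∩ openConn c b) := by
  have key := KnQ8Z.ratio_transfer w c X hcX
    (fun C E => ((openGraph E).Reachable o a ∧ ¬ (o = c ∨ ∃ e ∈ C, o ∈ e)) ∧
      ∀ x ∈ A'', ((openGraph E).Reachable o x ∧ ¬ (o = c ∨ ∃ e ∈ C, o ∈ e)))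
    (fun C E => (openGraph E).Reachable a b ∧ ¬ (a = c ∨ ∃ e ∈ C, a ∈ e))
    (fun C _ => b = c ∨ ∃ e ∈ C, b ∈ e)
    (fun _ E => ∀ z ∈ Z, ¬ (openGraph E).Reachable o z)
    (fun _ _ _ hCC' h => ⟨⟨h.1.1, fun h' => h.1.2 (h'.imp id fun ⟨e, he, hxe⟩ => ⟨e, hCC' he, hxe⟩)⟩,
      fun x hx => ⟨(h.2 x hx).1, fun h' => (h.2 x hx).2 (h'.imp id fun ⟨e, he, hxe⟩ => ⟨e, hCC' he, hxe⟩)⟩⟩)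
    (fun _ _ _ hEE' h => ⟨⟨h.1.1.mono (openGraph_le hEE'), h.1.2⟩,
      fun x hx => ⟨(h.2 x hx).1.mono (openGraph_le hEE'), (h.2 x hx).2⟩⟩)
    (fun _ _ _ hCC' h => ⟨h.1, fun h' => h.2 (h'.imp id fun ⟨e, he, hxe⟩ => ⟨e, hCC' he, hxe⟩)⟩)
    (fun _ _ _ hEE' h => ⟨h.1.mono (openGraph_le hEE'), h.2⟩)
    (fun _ _ _ hCC' h => h.imp id fun ⟨e, he, hze⟩ => ⟨e, hCC' he, hze⟩) (fun _ _ _ _ h => h)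
    (fun _ _ _ _ h => h) (fun _ _ _ hEE' h z hz hr => h z hz (hr.mono (openGraph_le hEE')))
  -- identify the events
  have hpt : ∀ (x : V) (ω : BondConfig V),
      ((openGraph (ω \ B⟦openEdgeCluster ω c, c⟧)).Reachable o x ∧ ¬ (o = c ∨ ∃ e ∈ openEdgeCluster ω c, o ∈ e)) ↔
        ω ∈ (openConn o x ∩ (openConn o c)ᶜ : Set (BondConfig V)) := by
    intro x ω
    have h := (OffCluster.openConn_inter_compl_eq c o x).symm
    exact Set.ext_iff.1 h ω
  have eQ : {ω : BondConfig V | ((openGraph (ω \ B⟦openEdgeCluster ω c, c⟧)).Reachable o a ∧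
        ¬ (o = c ∨ ∃ e ∈ openEdgeCluster ω c, o ∈ e)) ∧
      ∀ x ∈ A'', ((openGraph (ω \ B⟦openEdgeCluster ω c, c⟧)).Reachable o x ∧
        ¬ (o = c ∨ ∃ e ∈ openEdgeCluster ω c, o ∈ e))} =
      J⟦o, a, A''⟧ ∩ (openConn o c)ᶜ := by
    ext ω
    simp only [mem_setOf_eq, mem_inter_iff, mem_compl_iff]
    constructor
    · rintro ⟨h1, h2⟩
      have h1' := (hpt a ω).1 h1
      refine ⟨⟨h1'.1, fun x hx => ((hpt x ω).1 (h2 x hx)).1⟩, h1'.2⟩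
    · rintro ⟨⟨hoa, hA⟩, hoc⟩
      exact ⟨(hpt a ω).2 ⟨hoa, hoc⟩, fun x hx => (hpt x ω).2 ⟨hA x hx, hoc⟩⟩
  have eA : {ω : BondConfig V | (openGraph (ω \ B⟦openEdgeCluster ω c, c⟧)).Reachable a b ∧
      ¬ (a = c ∨ ∃ e ∈ openEdgeCluster ω c, a ∈ e)} = openConn a b ∩ (openConn a c)ᶜ :=
    (OffCluster.openConn_inter_compl_eq c a b).symm
  have eB : {ω : BondConfig V | b = c ∨ ∃ e ∈ openEdgeCluster ω c, b ∈ e} = openConn c b :=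
    (OffCluster.openConn_eq_setOf c b).symm
  simp only [eQ, eA, eB] at key
  -- on `D`, `J ∩ {o↮c} = J`
  have eD : D⟦c, X⟧ ∩ (J⟦o, a, A''⟧ ∩ (openConn o c)ᶜ) = D⟦c, X⟧ ∩ J⟦o, a, A''⟧ := by
    ext ω
    simp only [mem_inter_iff, mem_setOf_eq, mem_compl_iff, openConn]
    constructor
    · rintro ⟨hD, hJ, -⟩; exact ⟨hD, hJ⟩
    · rintro ⟨hD, hJ⟩; exact ⟨hD, hJ, fun h => hD o hoX h.symm⟩
  rw [eD] at key
  -- `{o↮Z}` off `C̄_c` is `{o↮Z}` on `D`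
  have eF : D⟦c, X⟧ ∩ {ω : BondConfig V | ∀ z ∈ Z,
      ¬ (openGraph (ω \ B⟦openEdgeCluster ω c, c⟧)).Reachable o z} =
      D⟦c, X⟧ ∩ {ω | ∀ z ∈ Z, ¬ (openGraph ω).Reachable o z} := by
    ext ω
    simp only [mem_inter_iff, mem_setOf_eq]
    constructor
    · rintro ⟨hD, h⟩
      exact ⟨hD, fun z hz hr => h z hz ((KnQ8Z.reachable_off_iff' (hD o hoX) z).1 hr)⟩
    · rintro ⟨hD, h⟩
      exact ⟨hD, fun z hz hr => h z hz ((KnQ8Z.reachable_off_iff' (hD o hoX) z).2 hr)⟩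
  rw [eF] at key
  exact key

/-! ### The joint bracket at the designated relay -/

/-- **Joint bracket, core form.**  `a ≠ c`, `o ≠ c`; `N = {c↮a} ∩ {c↮o}`.  If
`μ(N ∩ {o↮Z} ∩ {c↔b}) ≤ μ(N ∩ {o↮Z} ∩ {a↔b})` and the latter is positive, then for every vertex set `A''`:
`μ({o↔a} ∩ {o↔A''} ∩ {o↮c} ∩ {c↔b}) ≤ μ({o↔a} ∩ {o↔A''} ∩ {o↮c} ∩ {o↔b})`.
[cite: KozmaNitzan2024, Questions 8–9 (§5.5 p. 36), display (41)] [cite: VandenbergHaggstromKahn2005, Thms. 1.3–1.5 (pp. 6–8)] -/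
theorem joint_core (w : Sym2 V → unitInterval) (o b a c : V) (hac : a ≠ c) (hoc : o ≠ c) (A'' Z : Set V)
    (hmin : (prodBernoulli w).real
        ({ω : BondConfig V | ∀ x ∈ ({a, o} : Set V), ¬ (openGraph ω).Reachable c x} ∩
          {ω | ∀ z ∈ Z, ¬ (openGraph ω).Reachable o z} ∩ openConn c b) ≤
      (prodBernoulli w).real
        ({ω : BondConfig V | ∀ x ∈ ({a, o} : Set V), ¬ (openGraph ω).Reachable c x} ∩
          {ω | ∀ z ∈ Z, ¬ (openGraph ω).Reachable o z} ∩ openConn a b))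
    (hpos : 0 < (prodBernoulli w).real
        ({ω : BondConfig V | ∀ x ∈ ({a, o} : Set V), ¬ (openGraph ω).Reachable c x} ∩
          {ω | ∀ z ∈ Z, ¬ (openGraph ω).Reachable o z} ∩ openConn a b)) :
    (prodBernoulli w).real (J⟦o, a, A''⟧ ∩ (openConn o c)ᶜ ∩ openConn c b) ≤
      (prodBernoulli w).real (J⟦o, a, A''⟧ ∩ (openConn o c)ᶜ ∩ openConn o b) := by
  set μ := prodBernoulli w with hμ
  set X : Set V := {a, o} with hX
  have hoX : o ∈ X := by simp [hX]
  have haX : a ∈ X := by simp [hX]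
  have hcX : c ∉ X := by
    simp only [hX, mem_insert_iff, mem_singleton_iff, not_or]
    exact ⟨fun h => hac h.symm, fun h => hoc h.symm⟩
  have key := ratio_transfer_joint w o a c b A'' X hoX hcX Z
  -- on `D = {c ↮ X}` the guard `a ↮ c` is automatic
  have eA : ∀ E : Set (BondConfig V), D⟦c, X⟧ ∩ E ∩ (openConn a b ∩ (openConn a c)ᶜ) =
      D⟦c, X⟧ ∩ E ∩ openConn a b := by
    intro E
    ext ω
    simp only [mem_inter_iff, mem_setOf_eq, mem_compl_iff, openConn]
    constructor
    · rintro ⟨⟨hD, hE⟩, hab, -⟩; exact ⟨⟨hD, hE⟩, hab⟩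
    · rintro ⟨⟨hD, hE⟩, hab⟩; exact ⟨⟨hD, hE⟩, hab, fun h => hD a haX h.symm⟩
  rw [eA, eA] at key
  have hqa : 0 ≤ μ.real (D⟦c, X⟧ ∩ J⟦o, a, A''⟧ ∩ openConn a b) := measureReal_nonneg
  have h2 : μ.real (D⟦c, X⟧ ∩ J⟦o, a, A''⟧ ∩ openConn c b) *
      μ.real (D⟦c, X⟧ ∩ {ω | ∀ z ∈ Z, ¬ (openGraph ω).Reachable o z} ∩ openConn a b) ≤
      μ.real (D⟦c, X⟧ ∩ J⟦o, a, A''⟧ ∩ openConn a b) *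
      μ.real (D⟦c, X⟧ ∩ {ω | ∀ z ∈ Z, ¬ (openGraph ω).Reachable o z} ∩ openConn a b) :=
    key.trans (mul_le_mul_of_nonneg_left hmin hqa)
  have h3 : μ.real (D⟦c, X⟧ ∩ J⟦o, a, A''⟧ ∩ openConn c b) ≤
      μ.real (D⟦c, X⟧ ∩ J⟦o, a, A''⟧ ∩ openConn a b) := le_of_mul_le_mul_right h2 hpos
  -- the left event is the claimed one, the right event is contained in the claimed one
  have e1 : D⟦c, X⟧ ∩ J⟦o, a, A''⟧ ∩ openConn c b = J⟦o, a, A''⟧ ∩ (openConn o c)ᶜ ∩ openConn c b := by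
    ext ω
    simp only [mem_inter_iff, mem_setOf_eq, mem_compl_iff, openConn, hX, mem_insert_iff, mem_singleton_iff,
      forall_eq_or_imp, forall_eq]
    constructor
    · rintro ⟨⟨⟨hca, hco⟩, hJ⟩, hcb⟩
      exact ⟨⟨hJ, fun h => hco h.symm⟩, hcb⟩
    · rintro ⟨⟨⟨hoa, hA⟩, hoc'⟩, hcb⟩
      refine ⟨⟨⟨fun h => hoc' (hoa.trans h.symm), fun h => hoc' h.symm⟩, hoa, hA⟩, hcb⟩
  have e2 : D⟦c, X⟧ ∩ J⟦o, a, A''⟧ ∩ openConn a b ⊆ J⟦o, a, A''⟧ ∩ (openConn o c)ᶜ ∩ openConn o b := by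
    rintro ω ⟨⟨hD, hoa, hA⟩, hab⟩
    have hco : ¬ (openGraph ω).Reachable c o := hD o hoX
    exact ⟨⟨⟨hoa, hA⟩, fun h => hco (SimpleGraph.Reachable.symm h)⟩, SimpleGraph.Reachable.trans hoa hab⟩
  rw [e1] at h3
  exact h3.trans (measureReal_mono e2 (measure_ne_top _ _))

/-- **Joint bracket, every minimiser, no sure pairs** (ties via `KnQ8Z.real_avoid_pos_of_real_pos`: if the comparison
has no positive mass then the offending event is null). [cite: KozmaNitzan2024, Questions 8–9 (§5.5 p. 36)] -/
theorem joint_of_lt_one (w : Sym2 V → unitInterval) (hw : ∀ e, w e < 1) (o b a c : V) (hac : a ≠ c) (hoc : o ≠ c)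
    (A'' Z : Set V) (hoZ : o ∉ Z)
    (hmin : (prodBernoulli w).real
        ({ω : BondConfig V | ∀ x ∈ ({a, o} : Set V), ¬ (openGraph ω).Reachable c x} ∩
          {ω | ∀ z ∈ Z, ¬ (openGraph ω).Reachable o z} ∩ openConn c b) ≤
      (prodBernoulli w).real
        ({ω : BondConfig V | ∀ x ∈ ({a, o} : Set V), ¬ (openGraph ω).Reachable c x} ∩
          {ω | ∀ z ∈ Z, ¬ (openGraph ω).Reachable o z} ∩ openConn a b)) :
    (prodBernoulli w).real (J⟦o, a, A''⟧ ∩ (openConn o c)ᶜ ∩ openConn c b) ≤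
      (prodBernoulli w).real (J⟦o, a, A''⟧ ∩ (openConn o c)ᶜ ∩ openConn o b) := by
  by_cases hpos : 0 < (prodBernoulli w).real
      ({ω : BondConfig V | ∀ x ∈ ({a, o} : Set V), ¬ (openGraph ω).Reachable c x} ∩
        {ω | ∀ z ∈ Z, ¬ (openGraph ω).Reachable o z} ∩ openConn a b)
  · exact joint_core w o b a c hac hoc A'' Z hmin hpos
  · have hfa : (prodBernoulli w).real
        ({ω : BondConfig V | ∀ x ∈ ({a, o} : Set V), ¬ (openGraph ω).Reachable c x} ∩
          {ω | ∀ z ∈ Z, ¬ (openGraph ω).Reachable o z} ∩ openConn a b) = 0 :=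
      le_antisymm (not_lt.1 hpos) measureReal_nonneg
    have hfb : (prodBernoulli w).real
        ({ω : BondConfig V | ∀ x ∈ ({a, o} : Set V), ¬ (openGraph ω).Reachable c x} ∩
          {ω | ∀ z ∈ Z, ¬ (openGraph ω).Reachable o z} ∩ openConn c b) = 0 :=
      le_antisymm (hfa ▸ hmin) measureReal_nonneg
    -- the claimed left event is contained in `N ∩ {a↔o} ∩ {c↔b}`, which is null
    have hsub : J⟦o, a, A''⟧ ∩ (openConn o c)ᶜ ∩ openConn c b ⊆
        {ω : BondConfig V | ∀ x ∈ ({a, o} : Set V), ¬ (openGraph ω).Reachable c x} ∩ openConn a o ∩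
          openConn c b := by
      rintro ω ⟨⟨⟨hoa, -⟩, hoc'⟩, hcb⟩
      simp only [mem_inter_iff, mem_setOf_eq, mem_insert_iff, mem_singleton_iff, forall_eq_or_imp, forall_eq,
        mem_compl_iff, openConn] at hoa hoc' hcb ⊢
      exact ⟨⟨⟨fun h => hoc' (hoa.trans h.symm), fun h => hoc' h.symm⟩, hoa.symm⟩, hcb⟩
    have hqb : (prodBernoulli w).real
        ({ω : BondConfig V | ∀ x ∈ ({a, o} : Set V), ¬ (openGraph ω).Reachable c x} ∩ openConn a o ∩
          openConn c b) = 0 := by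
      by_contra hne
      have hq : 0 < (prodBernoulli w).real
          ({ω : BondConfig V | ∀ x ∈ ({a, o} : Set V), ¬ (openGraph ω).Reachable c x} ∩ openConn a o ∩
            openConn c b) := lt_of_le_of_ne measureReal_nonneg (Ne.symm hne)
      have := KnQ8Z.real_avoid_pos_of_real_pos w hw o b a c Z hoZ hq
      rw [hfb] at this
      exact lt_irrefl _ this
    have hle : (prodBernoulli w).real (J⟦o, a, A''⟧ ∩ (openConn o c)ᶜ ∩ openConn c b) ≤ 0 := by
      rw [← hqb]; exact measureReal_mono hsub (measure_ne_top _ _)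
    exact hle.trans measureReal_nonneg

/-- **Joint bracket at the pocket-designated relay.**  No sure pairs, `a ≠ c`, `o ≠ c`, a vertex set `Z` with `c ∈ Z`,
`o ∉ Z`, and the SINGLE comparison `μ({c↔b} ∩ {o↮Z}) ≤ μ({a↔b} ∩ {o↮Z})` (as for Question 8, `Z = A`, or Question 9,
`Z = {o}ᶜ`).  Then for EVERY vertex set `A''`:
`μ({o↔a} ∩ {o↔A''} ∩ {o↮c} ∩ {c↔b}) ≤ μ({o↔a} ∩ {o↔A''} ∩ {o↮c} ∩ {o↔b})`.
`A'' = ∅` is `KnQ8Z.knQuestion8Z_pair` (restricted to `{o↮c}`); `A'' = {a'}` is `reachBoth` below.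
[cite: KozmaNitzan2024, Questions 8–9 (§5.5 p. 36), display (41)] [cite: VandenbergHaggstromKahn2005, Thms. 1.3–1.5 (pp. 6–8)] -/
theorem joint (w : Sym2 V → unitInterval) (hw : ∀ e, w e < 1) (o b a c : V) (hac : a ≠ c) (hoc : o ≠ c)
    (A'' Z : Set V) (hcZ : c ∈ Z) (hoZ : o ∉ Z)
    (hmin : (prodBernoulli w).real (openConn c b ∩ {ω | ∀ z ∈ Z, ¬ (openGraph ω).Reachable o z}) ≤
      (prodBernoulli w).real (openConn a b ∩ {ω | ∀ z ∈ Z, ¬ (openGraph ω).Reachable o z})) :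
    (prodBernoulli w).real (J⟦o, a, A''⟧ ∩ (openConn o c)ᶜ ∩ openConn c b) ≤
      (prodBernoulli w).real (J⟦o, a, A''⟧ ∩ (openConn o c)ᶜ ∩ openConn o b) := by
  set μ := prodBernoulli w with hμ
  set F : Set (BondConfig V) := {ω | ∀ z ∈ Z, ¬ (openGraph ω).Reachable o z} with hF
  set N : Set (BondConfig V) := {ω : BondConfig V | ∀ x ∈ ({a, o} : Set V), ¬ (openGraph ω).Reachable c x} with hN
  have hNiff : ∀ ω : BondConfig V, ω ∈ N ↔ ¬ (openGraph ω).Reachable c a ∧ ¬ (openGraph ω).Reachable c o := by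
    intro ω
    simp only [hN, mem_setOf_eq, mem_insert_iff, mem_singleton_iff, forall_eq_or_imp, forall_eq]
  have hmca : MeasurableSet (openConn c a : Set (BondConfig V)) := MeasurableSet.of_discrete
  have s1 := measureReal_inter_add_sdiff (μ := μ) (s := openConn c b ∩ F) hmca
  have s2 := measureReal_inter_add_sdiff (μ := μ) (s := openConn a b ∩ F) hmca
  have e1 : (openConn c b ∩ F) \ openConn c a = N ∩ F ∩ openConn c b := by
    ext ω
    simp only [mem_sdiff, mem_inter_iff, hNiff, hF, mem_setOf_eq, openConn]
    constructor
    · rintro ⟨⟨hcb, hFz⟩, hca⟩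
      exact ⟨⟨⟨hca, fun h => hFz c hcZ h.symm⟩, hFz⟩, hcb⟩
    · rintro ⟨⟨⟨hca, -⟩, hFz⟩, hcb⟩
      exact ⟨⟨hcb, hFz⟩, hca⟩
  have e2 : (openConn a b ∩ F) \ openConn c a = N ∩ F ∩ openConn a b := by
    ext ω
    simp only [mem_sdiff, mem_inter_iff, hNiff, hF, mem_setOf_eq, openConn]
    constructor
    · rintro ⟨⟨hab, hFz⟩, hca⟩
      exact ⟨⟨⟨hca, fun h => hFz c hcZ h.symm⟩, hFz⟩, hab⟩
    · rintro ⟨⟨⟨hca, -⟩, hFz⟩, hab⟩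
      exact ⟨⟨hab, hFz⟩, hca⟩
  have e3 : openConn c b ∩ F ∩ openConn c a = openConn a b ∩ F ∩ openConn c a := by
    ext ω
    simp only [mem_inter_iff, hF, mem_setOf_eq, openConn]
    constructor
    · rintro ⟨⟨hcb, hFz⟩, hca⟩; exact ⟨⟨hca.symm.trans hcb, hFz⟩, hca⟩
    · rintro ⟨⟨hab, hFz⟩, hca⟩; exact ⟨⟨hca.trans hab, hFz⟩, hca⟩
  rw [e1, e3] at s1
  rw [e2] at s2
  have hcore : μ.real (N ∩ F ∩ openConn c b) ≤ μ.real (N ∩ F ∩ openConn a b) := by linarith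
  exact joint_of_lt_one w hw o b a c hac hoc A'' Z hoZ hcore

/-- **"Observer reaches both other relays" bracket is nonnegative at the designated relay.**  No sure pairs, `a ≠ c`,
`o ≠ c`, `c ∈ Z ∌ o`, `μ({c↔b} ∩ {o↮Z}) ≤ μ({a↔b} ∩ {o↮Z})`.  Then for every vertex `a'`:
`μ({o↔a} ∩ {o↔a'} ∩ {o↮c} ∩ {c↔b}) ≤ μ({o↔a} ∩ {o↔a'} ∩ {o↮c} ∩ {o↔b})` — for `A = {c, a, a'}` and `Z = A` this
is the bracket `[E_aa'] ≥ 0` of the three-relay anatomy of Question 8 (the pair brackets are ineq-gen-6's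
`KnQ8Z.knQuestion8Z_pair`). [cite: KozmaNitzan2024, Questions 8–9 (§5.5 p. 36), display (41)] -/
theorem reachBoth (w : Sym2 V → unitInterval) (hw : ∀ e, w e < 1) (o b a a' c : V) (hac : a ≠ c) (hoc : o ≠ c)
    (Z : Set V) (hcZ : c ∈ Z) (hoZ : o ∉ Z)
    (hmin : (prodBernoulli w).real (openConn c b ∩ {ω | ∀ z ∈ Z, ¬ (openGraph ω).Reachable o z}) ≤
      (prodBernoulli w).real (openConn a b ∩ {ω | ∀ z ∈ Z, ¬ (openGraph ω).Reachable o z})) :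
    (prodBernoulli w).real (openConn o a ∩ openConn o a' ∩ (openConn o c)ᶜ ∩ openConn c b) ≤
      (prodBernoulli w).real (openConn o a ∩ openConn o a' ∩ (openConn o c)ᶜ ∩ openConn o b) := by
  have key := joint w hw o b a c hac hoc ({a'} : Set V) Z hcZ hoZ hmin
  have eJ : ((openConn o a : Set (BondConfig V)) ∩ {ω : BondConfig V | ∀ x ∈ ({a'} : Set V),
      (openGraph ω).Reachable o x}) = openConn o a ∩ openConn o a' := by
    ext ω
    simp only [mem_inter_iff, mem_setOf_eq, mem_singleton_iff, forall_eq, openConn]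
  rw [eJ] at key
  exact key

end KnQ8J

end Summit.CriticalPhenomena.PercolationContinuityZ3.Theorems
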